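import Literature.MathematicalPhysics.QuantumFieldTheory.Balaban1983to89.Beta.FluctuationProjection
import Literature.MathematicalPhysics.QuantumFieldTheory.Balaban1983to89.B5Eq194DivG

/-!
# `BalabanUV.Beta.FP.CovarianceGaugeFactor` — road «FP» (binder row D1), lane IR-5′, **THE (T0′) SUPPLIER CHAIN, FILE 1: THE GAUGE FACTOR OF THE
# HARD COVARIANCE IS FREE × COARSE** (INTENT 3, journal l.31430; census (C) of l.31222 as CORRECTED by E-d1leaf05g18-1, l.31360):
# `R·∂*·G = R·Δ⁻¹·∂*` EXACTLY for B5's `G = Δ_a⁻¹`, `R = Π` (B5 (1.78) + «`RΔ⁻¹Q′* = 0`»), hence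
# `𝒞 = G − ∂·Δ⁻¹·R·Δ⁻¹·∂* − G·Q*(QGQ*)⁻¹Q·G` — NO `G` INSIDE THE GAUGE CORRECTION (our bookkeeping over b05 ∕ lit-balaban p37 BY NAME)

HONEST DEPENDENCY (page 1, mandatory): continuum YM on T⁴ ⇐ BetaPertH ∧ nine spine estimates (0/9 proved); BetaPertH ⇐ (D1) ∧ (D4) ∧
CAP+tail; G-an2-4 gates asym, D1 and NE2/3/4.  HONEST FRAMING (cell contract, verbatim): «discharging `BetaPertH` makes Bałaban's UV
stability UNCONDITIONAL — a real constructive-QFT result; it is NOT the continuum limit and NOT the Clay problem.»  THIS MODULE is finite-dimensional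
linear algebra over the tree's typed torus operators of B5 Sect. E (`B5DeltaA169.DeltaA`∕`calG`, `B5Value126.PcT` = (1.70), `B5Identities197Torus.RT`
= the p. 25 projection `Π`, `Beta.FluctuationProjection.Cov` = the hard-gauge∕hard-constraint covariance `𝒞 = 𝒫G`) composed BY NAME with lit-balaban
p37's typed B5 identities (`B5Eq194DivG.divS_eq178` = (1.78), `RT_mul_LapSinv_mul_QsAdj` = «`RΔ⁻¹Q′* = 0`», `B5Phi176Torus.G_constV` = (1.82)).
It cites nothing as a hypothesis, mints no `Prop`, has no `def`, 0 sorry; it proves NO estimate.  NOT (T0′) (the column-ℓ¹ letter of `FF-LEG-LETTERS.md` v2 §4),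
NOT hslice, NOT (ASYMP), NOT D1, NOT BetaPertH, NOT continuum, NOT Clay.

ABSOLUTE RULE (cell charter, verbatim): «No internally-minted statement may enter as a cited fact. Every hypothesis is either kernel-proved in this
package or a verbatim quotation of a PUBLISHED theorem with page reference. The manuscript(s) under audit are NOT citable for their own disputed
steps — they are the thing under adjudication; programme-internal (2001/route/tribunal) claims are never citable.»

WHY (the (T0′) supplier chain; `FF-LEG-LETTERS.md` v2 §4, journal l.31360).  The (R1) route's Γ-letter (T0′) `‖Γ_m‖_{∞→∞} ≤ A₀n²` is (1.115)'s first
entry for the HARD covariance `𝒞 = G − G∂R∂*G − H_kQG` (`FluctuationProjection.Cov_eq`); pv15 has `‖G‖_{∞→∞}` (`B5G115SupBound`), the constraint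
correction is `G·(coarse)·G`, and the GAUGE correction `G∂R∂*G` looks like it needs ∇-entries of the vector `G`.  It does not: by (1.78) the divergence of
`A = GJ` is `Δ⁻¹∂*J + Δ⁻¹Q′*(…)`, and `R = Π` kills `Δ⁻¹Q′*` (p. 33 «so `RΔ⁻¹Q′* = 0`»), so `R∂*G = RΔ⁻¹∂*` and `G∂R∂*G = (∂Δ⁻¹R)(RΔ⁻¹∂*)` — a
FREE scalar kernel dressed by the coarse projector, whose two `ℓ¹` letters are scalar (`RΔ⁻¹ = RG′`, B4's `G′`; files 2–4 of the chain).

CONTENT.  §1 `RT_divS_calG_mulVec_of_orthConst` (J ⊥ constants), `divS_calG_constV`, `RT_LapSinv_divS_constV` (the constant part: both sides vanish);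
§2 **`RT_divS_calG`** (`R·∂ᴴ·G = R·Δ⁻¹·∂ᴴ` as matrices), **`calG_grad_RT`** (its adjoint `G·∂·R = ∂·Δ⁻¹·R`); §3 **`calG_grad_gauge_divS_calG`**
(`G∂(1−P)∂ᴴG = ∂Δ⁻¹RΔ⁻¹∂ᴴ`), **`Cov_eq_free_gauge`** (`𝒞 = G − ∂Δ⁻¹RΔ⁻¹∂ᴴ − GQ*(QGQ*)⁻¹QG`); §4 **`RT_LapSinv_mul_opGp`**
(`R·Δ⁻¹·(Δ + aQ′*Q′) = R`: the coarse-projected free inverse is the coarse-projected scalar `G′`).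
Unit `b2b-balaban-beta-d1-formalise-leaf-05` (gen 18; D1 formalisation swarm leaf seat, road FP lane IR-5′), 2026-08-21; `LEAVES-FP.md` row «(T0′) CHAIN FILE 1».
«not in print beyond (1.78)∕(1.95)∕(1.107); our bookkeeping».
-/

noncomputable section

open scoped BigOperators Matrix ComplexConjugate

namespace Summit.QuantumFields.BalabanUV.Beta.FP.CovarianceGaugeFactor

open Literature.MathematicalPhysics.QuantumFieldTheory.Balaban1983to89
open Literature.MathematicalPhysics.QuantumFieldTheory.Balaban1983to89.B5Prop11Plancherel (Tor fine calG)
open Literature.MathematicalPhysics.QuantumFieldTheory.Balaban1983to89.B5Action121 (GradOp LapS)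
open Literature.MathematicalPhysics.QuantumFieldTheory.Balaban1983to89.B5Block118 (QsOp QvOp)
open Literature.MathematicalPhysics.QuantumFieldTheory.Balaban1983to89.B5LaplaceInverse (LapSinv LapSinv_conjTranspose LapSinv_mul_LapS)
open Literature.MathematicalPhysics.QuantumFieldTheory.Balaban1983to89.B5DeltaA169 (QvAdj DeltaA DeltaA_mul_calG calG_eq_DeltaA_inv)
open Literature.MathematicalPhysics.QuantumFieldTheory.Balaban1983to89.B5Value126 (PcT)
open Literature.MathematicalPhysics.QuantumFieldTheory.Balaban1983to89.B5Phi162Torus (OrthConst)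
open Literature.MathematicalPhysics.QuantumFieldTheory.Balaban1983to89.B5Hk160Torus (QsAdj constV divS_constV B0 Bp orthConst_Bp Bp_add_B0)
open Literature.MathematicalPhysics.QuantumFieldTheory.Balaban1983to89.B5Phi176Torus (orthConst_of_DeltaA_eq G_constV)
open Literature.MathematicalPhysics.QuantumFieldTheory.Balaban1983to89.B5Identities197Torus (RT RT_conjTranspose RT_mul_RT RT_mul_GradOp_adjoint)
open Literature.MathematicalPhysics.QuantumFieldTheory.Balaban1983to89.B5Eq194DivG (divS_eq178 RT_mul_LapSinv_mul_QsAdj RT_mul_Pker)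
open Literature.MathematicalPhysics.QuantumFieldTheory.Balaban1983to89.Beta.VectorPropagatorDict (ext_of_mulVec')
open Literature.MathematicalPhysics.QuantumFieldTheory.Balaban1983to89.Beta.LandauMultiplierIdentities (calG_conjTranspose)
open Literature.MathematicalPhysics.QuantumFieldTheory.Balaban1983to89.Beta.FluctuationProjection (Cov Cov_eq QGQ)

variable {d : ℕ} (n : ℕ) [NeZero n] (hn : 1 ≤ n) (M : Fin d → ℕ) [hM : ∀ μ, NeZero (M μ)] (a : ℝ) (ha : 0 < a)

/-! ## §1 `R∂*GJ = RΔ⁻¹∂*J` on `J ⊥ constants`, and on constants -/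

include hn ha in
/-- [our bookkeeping] **(1.78) + «`RΔ⁻¹Q′* = 0`» on the orthogonal complement of the constants**: for `J ⊥ constants`,
`R·∂ᴴ·(G J) = R·Δ⁻¹·∂ᴴ·J` — the two `Δ⁻¹Q′*(…)` terms of (1.78) die under `R = Π`. -/
theorem RT_divS_calG_mulVec_of_orthConst {J : Tor (fine n M) × Fin d → ℂ} (hJ : OrthConst (fine n M) J) :
    RT n M *ᵥ ((GradOp (fine n M) (n : ℂ))ᴴ *ᵥ (calG n hn M a ha *ᵥ J))
      = RT n M *ᵥ (LapSinv (fine n M) (n : ℂ) *ᵥ ((GradOp (fine n M) (n : ℂ))ᴴ *ᵥ J)) := by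
  have hA : DeltaA n M a *ᵥ (calG n hn M a ha *ᵥ J) = J := by
    rw [Matrix.mulVec_mulVec, DeltaA_mul_calG, Matrix.one_mulVec]
  have hAo : OrthConst (fine n M) (calG n hn M a ha *ᵥ J) := orthConst_of_DeltaA_eq n M a ha.ne' hJ hA
  have hkill : ∀ v : Tor M → ℂ, RT n M *ᵥ (LapSinv (fine n M) (n : ℂ) *ᵥ (QsAdj n M *ᵥ v)) = 0 := fun v => by
    rw [Matrix.mulVec_mulVec, Matrix.mulVec_mulVec, RT_mul_LapSinv_mul_QsAdj, Matrix.zero_mulVec]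
  rw [divS_eq178 n M a ha.le hA hAo, Matrix.mulVec_add, Matrix.mulVec_sub, Matrix.mulVec_smul, hkill, hkill, smul_zero,
    sub_zero, add_zero]

include hn ha in
/-- [our bookkeeping] the divergence of `G` on a constant configuration vanishes (`G A₀ = a⁻¹A₀`, (1.82); `∂ᴴA₀ = 0`). -/
theorem divS_calG_constV (c : Fin d → ℂ) :
    (GradOp (fine n M) (n : ℂ))ᴴ *ᵥ (calG n hn M a ha *ᵥ constV (fine n M) c) = 0 := by
  rw [calG_eq_DeltaA_inv, G_constV n M a ha, Matrix.mulVec_smul, divS_constV, smul_zero]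

/-- [our bookkeeping] and so does `R·Δ⁻¹·∂ᴴ` (`∂ᴴA₀ = 0`). -/
theorem RT_LapSinv_divS_constV (c : Fin d → ℂ) :
    RT n M *ᵥ (LapSinv (fine n M) (n : ℂ) *ᵥ ((GradOp (fine n M) (n : ℂ))ᴴ *ᵥ constV (fine n M) c)) = 0 := by
  rw [divS_constV, Matrix.mulVec_zero, Matrix.mulVec_zero]

/-! ## §2 The matrix identities `R·∂ᴴ·G = R·Δ⁻¹·∂ᴴ` and `G·∂·R = ∂·Δ⁻¹·R` -/

include ha in
/-- [our bookkeeping] **THE DIVERGENCE OF THE SOFT PROPAGATOR UNDER THE GAUGE PROJECTOR**: `R·∂ᴴ·G = R·Δ⁻¹·∂ᴴ` as matrices (`J = J′ + J₀`,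
`B5Hk160Torus.Bp_add_B0`; §1 on each part). -/
theorem RT_divS_calG :
    RT n M * (GradOp (fine n M) (n : ℂ))ᴴ * calG n hn M a ha = RT n M * LapSinv (fine n M) (n : ℂ) * (GradOp (fine n M) (n : ℂ))ᴴ := by
  refine ext_of_mulVec' fun J => ?_
  rw [← Bp_add_B0 (fine n M) J]
  simp only [← Matrix.mulVec_mulVec, Matrix.mulVec_add]
  rw [RT_divS_calG_mulVec_of_orthConst n hn M a ha (orthConst_Bp (fine n M) J)]
  congr 1
  rw [B0, divS_calG_constV n hn M a ha, RT_LapSinv_divS_constV, Matrix.mulVec_zero]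

include ha in
/-- [our bookkeeping] **THE ADJOINT**: `G·∂·R = ∂·Δ⁻¹·R` (`G`, `Δ⁻¹`, `R` Hermitian). -/
theorem calG_grad_RT :
    calG n hn M a ha * GradOp (fine n M) (n : ℂ) * RT n M = GradOp (fine n M) (n : ℂ) * LapSinv (fine n M) (n : ℂ) * RT n M := by
  have h := congrArg Matrix.conjTranspose (RT_divS_calG n hn M a ha)
  rw [Matrix.conjTranspose_mul, Matrix.conjTranspose_mul, Matrix.conjTranspose_mul, Matrix.conjTranspose_mul,
    Matrix.conjTranspose_conjTranspose, calG_conjTranspose, RT_conjTranspose, LapSinv_conjTranspose, ← Matrix.mul_assoc,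
    ← Matrix.mul_assoc] at h
  exact h

/-! ## §3 The gauge correction of the hard covariance is free × coarse -/

include ha in
/-- [our bookkeeping] **`G·∂·(1−P)·∂ᴴ·G = ∂·Δ⁻¹·R·Δ⁻¹·∂ᴴ`** (`(1−P)∂ᴴ = R∂ᴴ`, `R² = R`, §2 on both sides) — no `G` survives inside. -/
theorem calG_grad_gauge_divS_calG :
    calG n hn M a ha * GradOp (fine n M) (n : ℂ) * (1 - PcT n M (n : ℂ)) * (GradOp (fine n M) (n : ℂ))ᴴ * calG n hn M a ha
      = GradOp (fine n M) (n : ℂ) * LapSinv (fine n M) (n : ℂ) * RT n M * LapSinv (fine n M) (n : ℂ) * (GradOp (fine n M) (n : ℂ))ᴴ := by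
  calc calG n hn M a ha * GradOp (fine n M) (n : ℂ) * (1 - PcT n M (n : ℂ)) * (GradOp (fine n M) (n : ℂ))ᴴ * calG n hn M a ha
      = calG n hn M a ha * GradOp (fine n M) (n : ℂ) * (RT n M * (GradOp (fine n M) (n : ℂ))ᴴ) * calG n hn M a ha := by
        rw [RT_mul_GradOp_adjoint]; simp only [Matrix.mul_assoc]
    _ = calG n hn M a ha * GradOp (fine n M) (n : ℂ) * (RT n M * RT n M) * (GradOp (fine n M) (n : ℂ))ᴴ * calG n hn M a ha := by
        rw [RT_mul_RT]; simp only [Matrix.mul_assoc]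
    _ = (calG n hn M a ha * GradOp (fine n M) (n : ℂ) * RT n M) * (RT n M * (GradOp (fine n M) (n : ℂ))ᴴ * calG n hn M a ha) := by
        simp only [Matrix.mul_assoc]
    _ = (GradOp (fine n M) (n : ℂ) * LapSinv (fine n M) (n : ℂ) * RT n M) * (RT n M * LapSinv (fine n M) (n : ℂ) * (GradOp (fine n M) (n : ℂ))ᴴ) := by
        rw [calG_grad_RT n hn M a ha, RT_divS_calG n hn M a ha]
    _ = GradOp (fine n M) (n : ℂ) * LapSinv (fine n M) (n : ℂ) * (RT n M * RT n M) * LapSinv (fine n M) (n : ℂ) * (GradOp (fine n M) (n : ℂ))ᴴ := by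
        simp only [Matrix.mul_assoc]
    _ = _ := by rw [RT_mul_RT]

include ha in
/-- [our bookkeeping] **THE HARD COVARIANCE, GAUGE PART RESOLVED**: `𝒞 = G − ∂·Δ⁻¹·R·Δ⁻¹·∂ᴴ − G·Q*·(QGQ*)⁻¹·Q·G` — `Cov_eq` with §3's gauge
correction.  Every factor of the middle term is a FREE scalar operator (`Δ⁻¹ = LapSinv`, `∂ = GradOp`) or the coarse projector `R = Π` ((1.70)). -/
theorem Cov_eq_free_gauge :
    Cov n hn M a ha
      = calG n hn M a ha
        - GradOp (fine n M) (n : ℂ) * LapSinv (fine n M) (n : ℂ) * RT n M * LapSinv (fine n M) (n : ℂ) * (GradOp (fine n M) (n : ℂ))ᴴ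
        - calG n hn M a ha * QvAdj n M * (QGQ n hn M a ha)⁻¹ * QvOp n M * calG n hn M a ha := by
  rw [Cov_eq, ← calG_grad_gauge_divS_calG n hn M a ha]
  simp only [Matrix.mul_assoc]

include ha in
/-- [our bookkeeping] the same with the factors GROUPED for row-sum bookkeeping: `𝒞 = G − (∂Δ⁻¹R)·(RΔ⁻¹∂ᴴ) − G·(Q*(QGQ*)⁻¹Q)·G` (`R² = R`). -/
theorem Cov_eq_free_gauge' :
    Cov n hn M a ha
      = calG n hn M a ha
        - (GradOp (fine n M) (n : ℂ) * LapSinv (fine n M) (n : ℂ) * RT n M) * (RT n M * LapSinv (fine n M) (n : ℂ) * (GradOp (fine n M) (n : ℂ))ᴴ)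
        - calG n hn M a ha * (QvAdj n M * (QGQ n hn M a ha)⁻¹ * QvOp n M) * calG n hn M a ha := by
  have hRR : ∀ X : Matrix (Tor (fine n M)) (Tor (fine n M) × Fin d) ℂ, RT n M * (RT n M * X) = RT n M * X := fun X => by
    rw [← Matrix.mul_assoc, RT_mul_RT]
  rw [Cov_eq_free_gauge n hn M a ha]
  simp only [Matrix.mul_assoc, hRR]

/-! ## §4 The coarse-projected free inverse is the coarse-projected SCALAR propagator: `R·Δ⁻¹·(Δ + aQ′*Q′) = R` -/

/-- [our bookkeeping] **`R·Δ⁻¹ = R·G′` IN EQUATION FORM**: `R·Δ⁻¹·(Δ + a·Q′*Q′) = R` for every `a` — so on the range of B4's scalar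
operator `Δ + aQ′*Q′ = (G′)⁻¹` ((1.42); `B5GreenBridgeP12Dict.opD_embS`) the coarse-projected free inverse `R·Δ⁻¹` IS `R·G′`
(`Δ⁻¹Δ = 1 − P_const`, `R·P_const = 0`, «`RΔ⁻¹Q′* = 0`»): the two `ℓ¹` letters of `R·Δ⁻¹·∂ᴴ` that (T0′) needs are letters of the
MASSIVE scalar `G′` (lit-balaban `B5Prop12GpTorus.gp_blocks_top′`), not of the massless `Δ⁻¹`. -/
theorem RT_LapSinv_mul_opGp (b : ℝ) :
    RT n M * LapSinv (fine n M) (n : ℂ) * (LapS (fine n M) (n : ℂ) + (b : ℂ) • (QsAdj n M * QsOp n M)) = RT n M := by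
  rw [Matrix.mul_add, Matrix.mul_smul, Matrix.mul_assoc (RT n M) (LapSinv (fine n M) (n : ℂ)) (LapS (fine n M) (n : ℂ)),
    LapSinv_mul_LapS, Matrix.mul_sub, Matrix.mul_one, RT_mul_Pker, sub_zero, ← Matrix.mul_assoc, RT_mul_LapSinv_mul_QsAdj,
    Matrix.zero_mul, smul_zero, add_zero]

end Summit.QuantumFields.BalabanUV.Beta.FP.CovarianceGaugeFactor

end
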